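/-
Copyright (c) 2026 the pub-hodgecm-mathlib formalisation cell (harness21).  Prover seat hodgecm-mathlib-LH5-p03 (g2): (J-G′-JUMP) piece (c-wall) for line LH3's organ J
(LH3-plan (g3) deal 2026-09-02T07:56Z): the wall-factor binders `hwall`∕`hR` of ★ p850303's shell, from ★ p850207's wall factors; 2026-09-02.
-/
import Literature.NumberTheory.Automorphic.ArchCartanWallFactors   -- ★ p850207 (LH4-p03 (g4)): `archERhoG_mul_archRG_add_smul_nrm`, `tendsto_compactWallFactor_nhds_zero`; brings ★ `ArchCartanNormalisers`
import Literature.NumberTheory.Rogawski1990.ArchHCSpaceG            -- ★ p849664∕p849799 (LH3-p02 (g2)): `hcNrm`, `hcNrm_zero_two`, `HcSemireg`, `hcThird_zero_two`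
import HarnessLib

/-!
# The `ρ`-twisted normaliser of the compact `G′`-chart along the wall normal: `e^{ρ}·R′(p + ν·n) = 2 sin ν · R(ν)`, `R(ν) → r ≠ 0` (Shelstad 1979 §4; Rogawski 1990 §8.2)

Topic `NumberTheory/Rogawski1990`; namespace `Literature.NumberTheory.Rogawski1990`.  THEOREMS ONLY (no definition, no instance, no notation, no named fact, no `sorry`); group-free
and measure-free (an index type `W` of places, as ★ `ArchCartanWallFactors`); kernel lane `--supports stmt-HodgeConjecture-24833`.  Cell `pub/hodgecm-mathlib` (D-0151), crux H413 =
`stmt-HodgeConjecture-24833`, F0∕P3c line LH3 (closer stub `stub_N9`, DIRECT ROAD `F0_P3c_StubN9Direct`, organ J `JumpAgreementStatement`): brick (J-G′-JUMP), piece **(c-wall)** —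
the two `Φ`-INDEPENDENT binders of the ★ shell `ArchOrbFamGExtJumpOfBricks` (p850303, LH3-p02 (g2)):
`hwall : ∀ ν : ℝ, archERhoG S (p + ν • hcNrm w 0 2) * archRG S (p + ν • hcNrm w 0 2) = (2 * Real.sin ν : ℂ) * R ν` and `hR : Tendsto R (𝓝 0) (𝓝 r)`, INSTANTIATED from ★ p850207
`archERhoG_mul_archRG_add_smul_nrm` (LH4-p03 (g4)), with `r` explicit and `r ≠ 0` at a semiregular wall point (the (NONDEG) ratio of organ J divides by `r`).  HONEST LABEL: HC_CM is
proved only modulo the 7 printed citations (2 remaining named inputs: hLiu418 = `stmt-HodgeConjecture-24832`, h413 = `stmt-HodgeConjecture-24833`) until rung 0 closes; count-neutral.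

THE MATHEMATICS.  On the compact `G′`-chart `S` (`w ∉ S`), at a point `p` ON the wall `θ₀ = θ₂` of the place `w` (`p w 0 = p w 2 = θ`, `φ = p w 1`), along the normal
`p + ν·n`, `n = hcNrm w 0 2 = nrm w` (angles `θ + ν, φ, θ − ν` at `w`, the other places frozen): ★ p850207 gives
`e^{ρ}·R′ = [e^{iν}·2i sin ν·(1 − e^{i(φ−θ−ν)})(1 − e^{i(θ−ν−φ)})] · P`, `P = ∏_{w′ ≠ w}` (frozen factors at `p`).  Put `R(ν) := i·e^{iν}(1 − e^{i(φ−θ−ν)})(1 − e^{i(θ−ν−φ)})·P`;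
then `e^{ρ}·R′ = 2 sin ν · R(ν)` (the REAL factor `2 sin ν` pulled out, `i` inside `R`), `R(ν) → r := i·|e^{iθ} − e^{iφ}|²·P` (★ `tendsto_compactWallFactor_nhds_zero`), and `r ≠ 0`
as soon as `p` is SEMIREGULAR (★ `HcSemireg S w 0 2 p`: `e^{iφ} ≠ e^{iθ}` and `G`-regular at every `w′ ≠ w` — each frozen factor is then non-zero, as in ★ `archRG_ne_zero_of_mem_regG`).

* `archERhoG_mul_archRG_add_smul_hcNrm_eq` — the factorisation `= (2 sin ν : ℂ) * R ν` with `R` written out;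
* `tendsto_wallFactorR_nhds_zero` — `R(ν) → r` with `r` written out;
* `wallFactor_prod_erase_ne_zero_of_hcSemireg`, `wallFactorLimit_ne_zero_of_hcSemireg` — `P ≠ 0`, `r ≠ 0` at a semiregular wall point;
* **`exists_wallFactor_archERhoG_mul_archRG`** — `∃ R r, Tendsto R (𝓝 0) (𝓝 r) ∧ (∀ ν, … = (2 sin ν) * R ν) ∧ r = i·|e^{iθ}−e^{iφ}|²·P` (LH3-plan (g3)'s text);
* **`exists_wallFactor_archERhoG_mul_archRG_of_hcSemireg`** — the shell's `hwall`, `hR` AND `r ≠ 0` in one `obtain` from `HcSemireg S w 0 2 p` (the shell's own `hp`).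

## References
* [Shelstad1979] D. Shelstad, *Characters and inner forms of a quasi-split group over ℝ*, Compositio Math. 39 (1979), §4 pp. 22–26 (Lemma 4.3, Prop. 4.5).
* [Rogawski1990] J. D. Rogawski, *Automorphic Representations of Unitary Groups in Three Variables*, Ann. of Math. Stud. 123 (1990), §8.2 pp. 118–124 (p. 122: the curve
  `(θ+ψ, θ₁, θ−ψ)` and the factor `2i sin ψ`).
-/

set_option autoImplicit false

noncomputable section

open Complex Set Function Real Filter Topology
open Literature.NumberTheory.Automorphic.ArchCartan

namespace Literature.NumberTheory.Rogawski1990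

variable {W : Type*} [Fintype W] [DecidableEq W]

/-! ## §1 The factorisation along the normal with `R` written out -/

/-- **`e^{ρ}·R′(p + ν·n) = (2 sin ν)·R(ν)` ON THE COMPACT CHART ALONG THE WALL NORMAL**, with
`R(ν) = i·e^{iν}(1 − e^{i(φ−θ−ν)})(1 − e^{i(θ−ν−φ)})·∏_{w′ ≠ w}(frozen factors at p)` (`θ = p w 0 = p w 2`, `φ = p w 1`): ★ `archERhoG_mul_archRG_add_smul_nrm` through
★ `hcNrm_zero_two`, the real factor `2 sin ν` pulled out and `i` pushed into `R`. [cite: Rogawski1990, §8.2 p. 122] [cite: Shelstad1979, §4 p. 24; Lemma 4.3 (p. 25)] -/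
theorem archERhoG_mul_archRG_add_smul_hcNrm_eq (S : Finset W) {w : W} (hw : w ∉ S) {p : W → Fin 3 → ℝ} (hp : p w 0 = p w 2) (ν : ℝ) :
    archERhoG S (p + ν • hcNrm w 0 2) * archRG S (p + ν • hcNrm w 0 2) =
      (2 * Real.sin ν : ℂ) *
        (I * ((Circle.exp ν : ℂ) * ((1 - (Circle.exp (p w 1 - p w 0 - ν) : ℂ)) * (1 - (Circle.exp (p w 0 - ν - p w 1) : ℂ)))) *
          ∏ w' ∈ Finset.univ.erase w,
            ((if w' ∈ S then (1 : ℂ) else (Circle.exp (p w' 0 - p w' 2) : ℂ)) *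
              (if w' ∈ S then
                  ((|Real.exp (p w' 0) - Real.exp (-p w' 0)| *
                    ‖Complex.exp (p w' 0 + p w' 2 * I) - Complex.exp (p w' 1 * I)‖ * ‖Complex.exp (-p w' 0 + p w' 2 * I) - Complex.exp (p w' 1 * I)‖ : ℝ) : ℂ)
                else (1 - (Circle.exp (p w' 1 - p w' 0) : ℂ)) * (1 - (Circle.exp (p w' 2 - p w' 0) : ℂ)) * (1 - (Circle.exp (p w' 2 - p w' 1) : ℂ))))) := by
  rw [hcNrm_zero_two, archERhoG_mul_archRG_add_smul_nrm S hw hp ν]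
  ring

/-! ## §2 The limit of `R` at the wall -/

/-- **`R(ν) → r = i·|e^{iθ} − e^{iφ}|²·∏_{w′ ≠ w}(frozen factors)`** as `ν → 0` (★ `tendsto_compactWallFactor_nhds_zero`: `e^{iν}(1 − e^{i(φ−θ−ν)})(1 − e^{i(θ−ν−φ)}) → |e^{iθ} − e^{iφ}|²`).
[cite: Rogawski1990, §8.2 p. 122] [cite: Shelstad1979, §4 p. 25] -/
theorem tendsto_wallFactorR_nhds_zero (S : Finset W) (w : W) (p : W → Fin 3 → ℝ) :
    Tendsto (fun ν : ℝ =>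
        I * ((Circle.exp ν : ℂ) * ((1 - (Circle.exp (p w 1 - p w 0 - ν) : ℂ)) * (1 - (Circle.exp (p w 0 - ν - p w 1) : ℂ)))) *
          ∏ w' ∈ Finset.univ.erase w,
            ((if w' ∈ S then (1 : ℂ) else (Circle.exp (p w' 0 - p w' 2) : ℂ)) *
              (if w' ∈ S then
                  ((|Real.exp (p w' 0) - Real.exp (-p w' 0)| *
                    ‖Complex.exp (p w' 0 + p w' 2 * I) - Complex.exp (p w' 1 * I)‖ * ‖Complex.exp (-p w' 0 + p w' 2 * I) - Complex.exp (p w' 1 * I)‖ : ℝ) : ℂ)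
                else (1 - (Circle.exp (p w' 1 - p w' 0) : ℂ)) * (1 - (Circle.exp (p w' 2 - p w' 0) : ℂ)) * (1 - (Circle.exp (p w' 2 - p w' 1) : ℂ)))))
      (𝓝 (0 : ℝ))
      (𝓝 (I * (((‖(Circle.exp (p w 0) : ℂ) - Circle.exp (p w 1)‖ ^ 2 : ℝ)) : ℂ) *
          ∏ w' ∈ Finset.univ.erase w,
            ((if w' ∈ S then (1 : ℂ) else (Circle.exp (p w' 0 - p w' 2) : ℂ)) *
              (if w' ∈ S then
                  ((|Real.exp (p w' 0) - Real.exp (-p w' 0)| *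
                    ‖Complex.exp (p w' 0 + p w' 2 * I) - Complex.exp (p w' 1 * I)‖ * ‖Complex.exp (-p w' 0 + p w' 2 * I) - Complex.exp (p w' 1 * I)‖ : ℝ) : ℂ)
                else (1 - (Circle.exp (p w' 1 - p w' 0) : ℂ)) * (1 - (Circle.exp (p w' 2 - p w' 0) : ℂ)) * (1 - (Circle.exp (p w' 2 - p w' 1) : ℂ)))))) :=
  (tendsto_const_nhds.mul (tendsto_compactWallFactor_nhds_zero (p w 0) (p w 1))).mul tendsto_const_nhds

/-! ## §3 Non-vanishing of the limit at a semiregular wall point -/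

/-- **The frozen factors do not vanish at a SEMIREGULAR wall point**: under ★ `HcSemireg S w 0 2 p`, every place `w′ ≠ w` is `G′`-regular (three distinct unit eigenvalues at a
compact place, `x ≠ 0` at a split place), so the product over `w′ ≠ w` of the `e^{ρ}·R′`-factors is non-zero (per-factor pattern of ★ `archRG_ne_zero_of_mem_regG`; the twist
factors are units). [cite: Shelstad1979, §4 p. 22] [cite: Rogawski1990, §8.2 p. 118] -/
theorem wallFactor_prod_erase_ne_zero_of_hcSemireg (S : Finset W) {w : W} {p : W → Fin 3 → ℝ} (hp : HcSemireg S w 0 2 p) :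
    (∏ w' ∈ Finset.univ.erase w,
        ((if w' ∈ S then (1 : ℂ) else (Circle.exp (p w' 0 - p w' 2) : ℂ)) *
          (if w' ∈ S then
              ((|Real.exp (p w' 0) - Real.exp (-p w' 0)| *
                ‖Complex.exp (p w' 0 + p w' 2 * I) - Complex.exp (p w' 1 * I)‖ * ‖Complex.exp (-p w' 0 + p w' 2 * I) - Complex.exp (p w' 1 * I)‖ : ℝ) : ℂ)
            else (1 - (Circle.exp (p w' 1 - p w' 0) : ℂ)) * (1 - (Circle.exp (p w' 2 - p w' 0) : ℂ)) * (1 - (Circle.exp (p w' 2 - p w' 1) : ℂ))))) ≠ 0 := by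
  obtain ⟨-, -, hinj, hsplit⟩ := hp
  refine Finset.prod_ne_zero_iff.2 fun w' hw' => ?_
  have hne : w' ≠ w := Finset.ne_of_mem_erase hw'
  refine mul_ne_zero ?_ ?_
  · by_cases hS : w' ∈ S
    · rw [if_pos hS]; exact one_ne_zero
    · rw [if_neg hS]; exact Circle.coe_ne_zero _
  · by_cases hS : w' ∈ S
    · rw [if_pos hS, Complex.ofReal_ne_zero]
      have hx : p w' 0 ≠ 0 := hsplit w' hS
      refine mul_ne_zero (mul_ne_zero ((abs_exp_sub_exp_neg_ne_zero_iff _).2 hx) (norm_exp_add_mul_I_sub_exp_mul_I_ne_zero hx _ _)) ?_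
      have hx' : -p w' 0 ≠ 0 := neg_ne_zero.2 hx
      simpa only [Complex.ofReal_neg] using norm_exp_add_mul_I_sub_exp_mul_I_ne_zero hx' (p w' 2) (p w' 1)
    · rw [if_neg hS]
      have hi := hinj w' hS hne
      refine mul_ne_zero (mul_ne_zero ((one_sub_coe_circleExp_sub_ne_zero_iff _ _).2 fun h => ?_)
        ((one_sub_coe_circleExp_sub_ne_zero_iff _ _).2 fun h => ?_)) ((one_sub_coe_circleExp_sub_ne_zero_iff _ _).2 fun h => ?_)
      · exact absurd (hi h) (by decide)
      · exact absurd (hi h) (by decide)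
      · exact absurd (hi h) (by decide)

/-- **The wall-factor limit `r = i·|e^{iθ} − e^{iφ}|²·∏_{w′ ≠ w}(…)` is NON-ZERO at a semiregular wall point** (`e^{iφ} ≠ e^{iθ}` is the second conjunct of ★ `HcSemireg`,
★ `hcThird_zero_two`; §3 for the product). The (NONDEG) ratio of organ J divides by this `r`. [cite: Shelstad1979, §4 p. 22; Prop. 4.5 (p. 26)] [cite: Rogawski1990, §8.2 p. 122] -/
theorem wallFactorLimit_ne_zero_of_hcSemireg (S : Finset W) {w : W} {p : W → Fin 3 → ℝ} (hp : HcSemireg S w 0 2 p) :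
    I * (((‖(Circle.exp (p w 0) : ℂ) - Circle.exp (p w 1)‖ ^ 2 : ℝ)) : ℂ) *
        ∏ w' ∈ Finset.univ.erase w,
          ((if w' ∈ S then (1 : ℂ) else (Circle.exp (p w' 0 - p w' 2) : ℂ)) *
            (if w' ∈ S then
                ((|Real.exp (p w' 0) - Real.exp (-p w' 0)| *
                  ‖Complex.exp (p w' 0 + p w' 2 * I) - Complex.exp (p w' 1 * I)‖ * ‖Complex.exp (-p w' 0 + p w' 2 * I) - Complex.exp (p w' 1 * I)‖ : ℝ) : ℂ)
              else (1 - (Circle.exp (p w' 1 - p w' 0) : ℂ)) * (1 - (Circle.exp (p w' 2 - p w' 0) : ℂ)) * (1 - (Circle.exp (p w' 2 - p w' 1) : ℂ)))) ≠ 0 := by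
  have hθφ : Circle.exp (p w 1) ≠ Circle.exp (p w 0) := by
    have h := hp.2.1
    rwa [hcThird_zero_two] at h
  refine mul_ne_zero (mul_ne_zero I_ne_zero ?_) (wallFactor_prod_erase_ne_zero_of_hcSemireg S hp)
  rw [Complex.ofReal_ne_zero]
  exact pow_ne_zero 2 (norm_ne_zero_iff.2 (sub_ne_zero.2 fun h => hθφ (Subtype.ext h).symm))

/-! ## §4 The packaged binders of the (J-G′-JUMP) shell -/

/-- **(c-wall) — LH3-plan (g3)'s text**: `∃ R r, Tendsto R (𝓝 0) (𝓝 r) ∧ (∀ ν, e^{ρ}·R′(p + ν·hcNrm w 0 2) = (2 sin ν)·R ν) ∧ r = i·|e^{iθ} − e^{iφ}|²·∏_{w′ ≠ w}(…)`, for `w ∉ S` and `p` on the wall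
`p w 0 = p w 2` (§1 + §2). [cite: Rogawski1990, §8.2 p. 122] [cite: Shelstad1979, Lemma 4.3 (p. 25)] -/
theorem exists_wallFactor_archERhoG_mul_archRG (S : Finset W) {w : W} (hw : w ∉ S) {p : W → Fin 3 → ℝ} (hp : p w 0 = p w 2) :
    ∃ R : ℝ → ℂ, ∃ r : ℂ, Tendsto R (𝓝 (0 : ℝ)) (𝓝 r) ∧
      (∀ ν : ℝ, archERhoG S (p + ν • hcNrm w 0 2) * archRG S (p + ν • hcNrm w 0 2) = (2 * Real.sin ν : ℂ) * R ν) ∧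
      r = I * (((‖(Circle.exp (p w 0) : ℂ) - Circle.exp (p w 1)‖ ^ 2 : ℝ)) : ℂ) *
        ∏ w' ∈ Finset.univ.erase w,
          ((if w' ∈ S then (1 : ℂ) else (Circle.exp (p w' 0 - p w' 2) : ℂ)) *
            (if w' ∈ S then
                ((|Real.exp (p w' 0) - Real.exp (-p w' 0)| *
                  ‖Complex.exp (p w' 0 + p w' 2 * I) - Complex.exp (p w' 1 * I)‖ * ‖Complex.exp (-p w' 0 + p w' 2 * I) - Complex.exp (p w' 1 * I)‖ : ℝ) : ℂ)
              else (1 - (Circle.exp (p w' 1 - p w' 0) : ℂ)) * (1 - (Circle.exp (p w' 2 - p w' 0) : ℂ)) * (1 - (Circle.exp (p w' 2 - p w' 1) : ℂ)))) :=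
  ⟨_, _, tendsto_wallFactorR_nhds_zero S w p, archERhoG_mul_archRG_add_smul_hcNrm_eq S hw hp, rfl⟩

/-- **(c-wall) AT A SEMIREGULAR WALL POINT — the shell's `hwall`, `hR` and `r ≠ 0` in one `obtain`**: from ★ `HcSemireg S w 0 2 p` (the very hypothesis `hp` of ★
`hasOneSidedJump_hcTwistedDeriv_orbFamGExt_of_bricks`) and `w ∉ S`: `∃ R r, Tendsto R (𝓝 0) (𝓝 r) ∧ (∀ ν, e^{ρ}·R′(p + ν·hcNrm w 0 2) = (2 sin ν)·R ν) ∧ r ≠ 0`.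
[cite: Shelstad1979, Prop. 4.5 (p. 26)] [cite: Rogawski1990, §8.2 pp. 122–124] -/
theorem exists_wallFactor_archERhoG_mul_archRG_of_hcSemireg (S : Finset W) {w : W} (hw : w ∉ S) {p : W → Fin 3 → ℝ} (hp : HcSemireg S w 0 2 p) :
    ∃ R : ℝ → ℂ, ∃ r : ℂ, Tendsto R (𝓝 (0 : ℝ)) (𝓝 r) ∧
      (∀ ν : ℝ, archERhoG S (p + ν • hcNrm w 0 2) * archRG S (p + ν • hcNrm w 0 2) = (2 * Real.sin ν : ℂ) * R ν) ∧ r ≠ 0 := by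
  obtain ⟨R, r, hR, hwall, hr⟩ := exists_wallFactor_archERhoG_mul_archRG S hw hp.1
  exact ⟨R, r, hR, hwall, hr ▸ wallFactorLimit_ne_zero_of_hcSemireg S hp⟩

end Literature.NumberTheory.Rogawski1990

end
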